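import Literature.Analysis.Complex.RiemannDomainWeakDbar
import Literature.Analysis.Complex.WeylLemmaDbarSCV
import HarnessLib

/-!
# Weyl's lemma for `∂̄` on a flat Riemann domain

Layer `Literature/Analysis/Complex`. On a Riemann domain `D` over `ℂ^ι` (flat charts = local
inverses of `proj`, measure `vol` = chartwise Lebesgue measure):

**Theorem** (`exists_flatHolomorphic_ae_eq`). If `u` is locally `vol`-integrable with `∂̄ u = 0`
weakly (`HasWeakDbar D u 0`), then `u` agrees `vol`-a.e. with a continuous function `h` which is
holomorphic along every local inverse `e` of `proj` (`h ∘ e⁻¹` holomorphic on `e.target`).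

Proof: the weak equation transports to the chart targets (`HasWeakDbar.integral_target`), the
Euclidean Weyl lemma (`WeylSCV.weyl_dbar_scv_ball`) gives local holomorphic representatives, which
agree on overlaps (`vol` charges nonempty open sets) and patch along a countable subcover.
Everything is proved; no named facts.

## References

* L. Hörmander, *An Introduction to Complex Analysis in Several Variables* (1973), §4.2 (Cor. 4.2.6),
  §5.4 (Riemann domains). [HormanderSCV1973]

#harness_tags complex_analysis.several_variables, complex_analysis.l2_estimates, complex_geometry.riemann_existence
-/

noncomputable section

open scoped Topology ComplexConjugate ENNReal ContDiff Manifold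
open Set Filter Function Complex MeasureTheory Metric

namespace Literature.Analysis.Complex

namespace RiemannDomain

universe u

variable {ι : Type} [Fintype ι] {D : RiemannDomain.{u} ι}

/-! ### `vol` charges open sets; null sets and integrability along charts -/

/-- A local inverse of `proj` maps Borel subsets of its target to sets of the same measure:
`vol (e⁻¹ '' B) = λ(B)`. [folklore] -/
theorem vol_symm_image {e : OpenPartialHomeomorph D (ι → ℂ)} (he : ⇑e = D.proj) {B : Set (ι → ℂ)}
    (hB : MeasurableSet B) (hBe : B ⊆ e.target) : D.vol (e.symm '' B) = volume B := by
  have hsub : e.symm '' B ⊆ e.source := fun y ⟨z, hz, hzy⟩ ↦ hzy ▸ e.map_target (hBe hz)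
  have hmeas : MeasurableSet (e.symm '' B) := by
    rw [e.symm_image_eq_source_inter_preimage hBe, he]
    exact e.open_source.measurableSet.inter (D.measurable_proj hB)
  rw [vol_eq_volume_image he hmeas hsub, ← he, image_image,
    (show EqOn (fun z ↦ e (e.symm z)) id B from fun z hz ↦ e.right_inv (hBe hz)).image_eq_self]

/-- Null sets of a chart target pull back to `vol`-null sets. [folklore] -/
theorem vol_symm_image_eq_zero {e : OpenPartialHomeomorph D (ι → ℂ)} (he : ⇑e = D.proj) {N : Set (ι → ℂ)}
    (hN : volume N = 0) (hNe : N ⊆ e.target) : D.vol (e.symm '' N) = 0 := by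
  set N' := toMeasurable volume N ∩ e.target with hN'
  have hNN' : N ⊆ N' := subset_inter (subset_toMeasurable _ _) hNe
  have hN'0 : volume N' = 0 := measure_mono_null inter_subset_left (by rw [measure_toMeasurable]; exact hN)
  refine measure_mono_null (image_mono hNN') ?_
  rw [vol_symm_image he ((measurableSet_toMeasurable _ _).inter e.open_target.measurableSet) inter_subset_right]
  exact hN'0

/-- **A.e. statements transport from a chart target to its source.** [folklore] -/
theorem ae_source_of_ae_target {e : OpenPartialHomeomorph D (ι → ℂ)} (he : ⇑e = D.proj) {p : D → Prop}
    (h : ∀ᵐ z ∂volume, z ∈ e.target → p (e.symm z)) : ∀ᵐ y ∂D.vol, y ∈ e.source → p y := by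
  rw [ae_iff] at h ⊢
  have hsub : {y | ¬(y ∈ e.source → p y)} ⊆ e.symm '' {z | ¬(z ∈ e.target → p (e.symm z))} := by
    intro y hy
    simp only [mem_setOf_eq, Classical.not_imp] at hy ⊢
    refine ⟨e y, ⟨e.map_source hy.1, ?_⟩, e.left_inv hy.1⟩
    rw [e.left_inv hy.1]; exact hy.2
  refine measure_mono_null hsub (vol_symm_image_eq_zero he h fun z hz ↦ ?_)
  simp only [mem_setOf_eq, Classical.not_imp] at hz
  exact hz.1

/-- `vol` charges nonempty open sets. [folklore] -/
instance instIsOpenPosMeasure : (D.vol).IsOpenPosMeasure := by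
  refine ⟨fun O hO ⟨x, hx⟩ ↦ ?_⟩
  set e := D.chart x
  have he : ⇑e = D.proj := D.coe_chart x
  set B : Set (ι → ℂ) := e '' (O ∩ e.source) with hB
  have hBopen : IsOpen B := e.isOpen_image_of_subset_source (hO.inter e.open_source) inter_subset_right
  have hBne : B.Nonempty := ⟨e x, x, ⟨hx, D.mem_chart_source x⟩, rfl⟩
  have hBe : B ⊆ e.target := fun z ⟨y, hy, hyz⟩ ↦ hyz ▸ e.map_source hy.2
  have hBvol : 0 < volume B := hBopen.measure_pos volume hBne
  have hsymm : e.symm '' B = O ∩ e.source := by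
    rw [hB, image_image, (show EqOn (fun y ↦ e.symm (e y)) id (O ∩ e.source) from fun y hy ↦ e.left_inv hy.2).image_eq_self]
  intro h0
  have : D.vol (e.symm '' B) = 0 := measure_mono_null (by rw [hsymm]; exact inter_subset_left) h0
  rw [vol_symm_image he hBopen.measurableSet hBe] at this
  exact hBvol.ne' this

/-- **Integrability along a chart**: if `f` is `vol`-integrable on `e⁻¹(B)` for a Borel
`B ⊆ e.target`, then `f ∘ e⁻¹` is Lebesgue-integrable on `B`. [folklore] -/
theorem integrableOn_comp_symm {e : OpenPartialHomeomorph D (ι → ℂ)} (he : ⇑e = D.proj) {B : Set (ι → ℂ)}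
    (hB : MeasurableSet B) (hBe : B ⊆ e.target) {G' : Type*} [NormedAddCommGroup G'] {f : D → G'}
    (hf : IntegrableOn f (e.symm '' B) D.vol) : IntegrableOn (f ∘ e.symm) B volume := by
  have hmeas : AEMeasurable e.symm (volume.restrict e.target) := e.continuousOn_symm.aemeasurable e.open_target.measurableSet
  have hmeasB : AEMeasurable e.symm (volume.restrict B) := (e.continuousOn_symm.mono hBe).aemeasurable hB
  have hsub : e.symm '' B ⊆ e.source := fun y ⟨z, hz, hzy⟩ ↦ hzy ▸ e.map_target (hBe hz)
  have himB : MeasurableSet (e.symm '' B) := by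
    rw [e.symm_image_eq_source_inter_preimage hBe, he]
    exact e.open_source.measurableSet.inter (D.measurable_proj hB)
  have hpre : e.symm ⁻¹' (e.symm '' B) ∩ e.target = B := by
    ext z
    constructor
    · rintro ⟨⟨z', hz', hzz'⟩, hz⟩
      have : z' = z := by
        have h1 := congrArg e hzz'
        rwa [e.right_inv (hBe hz'), e.right_inv hz] at h1
      exact this ▸ hz'
    · exact fun hz ↦ ⟨⟨z, hz, rfl⟩, hBe hz⟩
  have h1 : D.vol.restrict (e.symm '' B) = (volume.restrict B).map e.symm := by
    have h2 : D.vol.restrict (e.symm '' B) = (D.vol.restrict e.source).restrict (e.symm '' B) := by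
      rw [Measure.restrict_restrict himB, inter_eq_left.2 hsub]
    rw [h2, ← map_symm_volume_restrict he, Measure.restrict_map_of_aemeasurable hmeas himB,
      Measure.restrict_restrict' e.open_target.measurableSet, hpre]
  rw [IntegrableOn, h1] at hf
  exact (integrable_map_measure hf.aestronglyMeasurable hmeasB).1 hf

/-! ### Weyl's lemma on `D` -/

variable [DecidableEq ι]

/-- **The local step**: near every point of an open set `O` on which the weak `∂̄ u` vanishes, `u`
agrees a.e. with `G ∘ proj` for a holomorphic `G` on a polydisc. [cite: HormanderSCV1973, §4.2 (Cor. 4.2.6)] -/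
theorem exists_local_holomorphic_ae_eq {u : D → ℂ} {g : D → ι → ℂ} (hu : HasWeakDbar D u g) {O : Set D} (hO : IsOpen O)
    (hg : ∀ y ∈ O, ∀ j, g y j = 0) {x : D} (hx : x ∈ O) :
    ∃ (R : ℝ) (G : (ι → ℂ) → ℂ), 0 < R ∧ closedBall (D.proj x) (3 * R) ⊆ (D.chart x).target ∧
      (D.chart x).symm '' closedBall (D.proj x) (3 * R) ⊆ O ∧
      DifferentiableOn ℂ G (ball (D.proj x) (3 * R / 2)) ∧
      ∀ᵐ y ∂D.vol, y ∈ (D.chart x).source → D.proj y ∈ ball (D.proj x) R → u y = G (D.proj y) := by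
  set e := D.chart x with hedef
  have he : ⇑e = D.proj := D.coe_chart x
  set z₀ := D.proj x with hz₀
  have hopen : IsOpen (e.target ∩ e.symm ⁻¹' O) := e.continuousOn_symm.isOpen_inter_preimage e.open_target hO
  have hz₀mem : z₀ ∈ e.target ∩ e.symm ⁻¹' O := ⟨D.proj_mem_chart_target x, by
    show e.symm z₀ ∈ O
    rw [hz₀, D.chart_symm_proj x]; exact hx⟩
  obtain ⟨ε, hε, hεt⟩ := Metric.isOpen_iff.1 hopen z₀ hz₀mem
  set R : ℝ := ε / 4 with hR
  have hR0 : 0 < R := by positivity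
  have hsub' : closedBall z₀ (3 * R) ⊆ e.target ∩ e.symm ⁻¹' O := (closedBall_subset_ball (by rw [hR]; linarith)).trans hεt
  have hsub : closedBall z₀ (3 * R) ⊆ e.target := hsub'.trans inter_subset_left
  have hsubO : e.symm '' closedBall z₀ (3 * R) ⊆ O := by
    rintro _ ⟨z, hz, rfl⟩; exact (hsub' hz).2
  -- the Euclidean datum
  set f : (ι → ℂ) → ℂ := (closedBall z₀ (3 * R)).indicator (u ∘ e.symm) with hf
  have hKc : IsCompact (e.symm '' closedBall z₀ (3 * R)) :=
    (isCompact_closedBall _ _).image_of_continuousOn (e.continuousOn_symm.mono hsub)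
  have hint : IntegrableOn f (closedBall z₀ (3 * R)) volume := by
    refine IntegrableOn.congr_fun (f := u ∘ e.symm) ?_ (fun z hz ↦ by rw [hf, indicator_of_mem hz]) measurableSet_closedBall
    exact integrableOn_comp_symm he measurableSet_closedBall hsub (hu.locallyIntegrable.integrableOn_isCompact hKc)
  have hweak : ∀ φ : (ι → ℂ) → ℂ, ContDiff ℝ ∞ φ → HasCompactSupport φ → tsupport φ ⊆ closedBall z₀ (3 * R) →
      ∀ j, ∫ z, f z * dbarAlong (Pi.single j 1) φ z = 0 := by
    intro φ hφ hφc hφs j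
    have hdb0 : ∀ z ∉ tsupport φ, dbarAlong (Pi.single j 1) φ z = 0 := fun z hz ↦ by
      have : fderiv ℝ φ z = 0 := by
        by_contra hne
        exact hz (support_fderiv_subset ℝ (mem_support.2 hne))
      simp [dbarAlong_apply, this]
    have hφ0 : ∀ z ∉ tsupport φ, φ z = 0 := fun z hz ↦ image_eq_zero_of_notMem_tsupport hz
    have hpt : ∀ z, f z * dbarAlong (Pi.single j 1) φ z = e.target.indicator (fun z ↦ u (e.symm z) * dbarAlong (Pi.single j 1) φ z) z := by
      intro z
      by_cases hz : z ∈ tsupport φ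
      · rw [hf, indicator_of_mem (hφs hz), indicator_of_mem (hsub (hφs hz))]; rfl
      · rw [hdb0 z hz, mul_zero]
        by_cases hzt : z ∈ e.target
        · rw [indicator_of_mem hzt, hdb0 z hz, mul_zero]
        · rw [indicator_of_notMem hzt]
    have hrhs : ∀ z, z ∈ e.target → g (e.symm z) j * φ z = 0 := fun z hzt ↦ by
      by_cases hz : z ∈ tsupport φ
      · rw [hg _ (hsub' (hφs hz)).2 j, zero_mul]
      · rw [hφ0 z hz, mul_zero]
    rw [integral_congr_ae (ae_of_all _ hpt), MeasureTheory.integral_indicator e.open_target.measurableSet,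
      hu.integral_target he hφ hφc (hφs.trans hsub) j, setIntegral_congr_fun e.open_target.measurableSet hrhs]
    simp
  obtain ⟨G, hG, hae⟩ := WeylSCV.weyl_dbar_scv_ball hR0 hint hweak
  refine ⟨R, G, hR0, hsub, hsubO, hG, ?_⟩
  refine ae_source_of_ae_target he ?_
  filter_upwards [hae] with z hz hzt hzb
  rw [D.proj_symm_apply he hzt] at hzb ⊢
  rw [← hz hzb, hf, indicator_of_mem (ball_subset_closedBall.trans (closedBall_subset_closedBall (by linarith)) hzb)]
  rfl

/-- **Weyl's lemma for `∂̄` on an open subset of a flat Riemann domain.** If `u` is locally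
`vol`-integrable with weak `∂̄ u = g` and `g = 0` on the open set `O`, then `u` agrees `vol`-a.e. on
`O` with a function `h` continuous on `O` and holomorphic along every local inverse `e` of `proj`
(on `e.target ∩ e⁻¹⁻¹(O)`). [cite: HormanderSCV1973, §4.2 (Cor. 4.2.6); §5.4] -/
theorem exists_flatHolomorphicOn_ae_eq {u : D → ℂ} {g : D → ι → ℂ} (hu : HasWeakDbar D u g) {O : Set D} (hO : IsOpen O)
    (hg : ∀ y ∈ O, ∀ j, g y j = 0) :
    ∃ h : D → ℂ, ContinuousOn h O ∧
      (∀ e : OpenPartialHomeomorph D (ι → ℂ), ⇑e = D.proj → DifferentiableOn ℂ (h ∘ e.symm) (e.target ∩ e.symm ⁻¹' O)) ∧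
      ∀ᵐ y ∂D.vol, y ∈ O → u y = h y := by
  classical
  choose R G hR hRt hRO hG hae using fun x : O ↦ exists_local_holomorphic_ae_eq hu hO hg x.2
  -- the open pieces
  set Op : O → Set D := fun x ↦ (D.chart (x : D)).source ∩ D.proj ⁻¹' ball (D.proj (x : D)) (R x) with hOp
  have hOopen : ∀ x, IsOpen (Op x) := fun x ↦
    (D.chart (x : D)).open_source.inter (isOpen_ball.preimage D.isLocalHomeomorph.continuous)
  have hOmem : ∀ x : O, (x : D) ∈ Op x := fun x ↦ ⟨D.mem_chart_source (x : D), by simp [mem_ball, hR x]⟩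
  have hOsub : ∀ x : O, Op x ⊆ O := by
    rintro x w ⟨hw1, hw2⟩
    refine hRO x ⟨D.proj w, ball_subset_closedBall.trans (closedBall_subset_closedBall (by linarith [hR x])) hw2, ?_⟩
    rw [← D.coe_chart (x : D)]
    exact (D.chart (x : D)).left_inv hw1
  have hOball : ∀ x : O, ∀ w ∈ Op x, D.proj w ∈ ball (D.proj (x : D)) (3 * R x / 2) := fun x w hw ↦
    ball_subset_ball (by linarith [hR x]) hw.2
  have hcont : ∀ x : O, ContinuousOn (fun w ↦ G x (D.proj w)) (Op x) := fun x ↦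
    (hG x).continuousOn.comp D.isLocalHomeomorph.continuous.continuousOn fun w hw ↦ hOball x w hw
  -- local representatives agree on overlaps
  have hagree : ∀ x y : O, ∀ w ∈ Op x ∩ Op y, G x (D.proj w) = G y (D.proj w) := by
    intro x y w hw
    have hV : IsOpen (Op x ∩ Op y) := (hOopen x).inter (hOopen y)
    have haexy : (fun w ↦ G x (D.proj w)) =ᵐ[D.vol.restrict (Op x ∩ Op y)] fun w ↦ G y (D.proj w) := by
      rw [EventuallyEq, ae_restrict_iff' hV.measurableSet]
      filter_upwards [hae x, hae y] with w hwx hwy hw'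
      rw [← hwx hw'.1.1 hw'.1.2, ← hwy hw'.2.1 hw'.2.2]
    exact Measure.eqOn_open_of_ae_eq haexy hV ((hcont x).mono inter_subset_left) ((hcont y).mono inter_subset_right) hw
  -- the patched function
  set h : D → ℂ := fun w ↦ if hw : w ∈ O then G ⟨w, hw⟩ (D.proj w) else 0 with hh
  have hh_loc : ∀ x : O, ∀ w ∈ Op x, h w = G x (D.proj w) := fun x w hw ↦ by
    have hwO : w ∈ O := hOsub x hw
    simp only [hh, dif_pos hwO]
    exact hagree ⟨w, hwO⟩ x w ⟨hOmem ⟨w, hwO⟩, hw⟩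
  have hh_ev : ∀ x : O, h =ᶠ[𝓝 (x : D)] fun w ↦ G x (D.proj w) := fun x ↦ by
    filter_upwards [(hOopen x).mem_nhds (hOmem x)] with w hw using hh_loc x w hw
  refine ⟨h, ?_, fun e he ↦ ?_, ?_⟩
  · intro x hx
    exact ((((hcont ⟨x, hx⟩).continuousAt ((hOopen _).mem_nhds (hOmem ⟨x, hx⟩))).congr (hh_ev ⟨x, hx⟩).symm).continuousWithinAt :)
  · rintro z ⟨hz, hzO⟩
    set w := e.symm z with hw
    have hzw : D.proj w = z := D.proj_symm_apply he hz
    -- near `z`, `h ∘ e⁻¹ = G_w`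
    have hpre : e.target ∩ e.symm ⁻¹' Op ⟨w, hzO⟩ ∈ 𝓝 z :=
      (e.continuousOn_symm.isOpen_inter_preimage e.open_target (hOopen _)).mem_nhds ⟨hz, hOmem ⟨w, hzO⟩⟩
    have hev : (h ∘ e.symm) =ᶠ[𝓝 z] G ⟨w, hzO⟩ := by
      filter_upwards [hpre] with z' hz'
      rw [Function.comp_apply, hh_loc ⟨w, hzO⟩ _ hz'.2, D.proj_symm_apply he hz'.1]
    have hd : DifferentiableAt ℂ (G ⟨w, hzO⟩) z := by
      refine (hG ⟨w, hzO⟩).differentiableAt (isOpen_ball.mem_nhds ?_)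
      rw [← hzw]; exact mem_ball_self (by linarith [hR ⟨w, hzO⟩])
    exact (hd.congr_of_eventuallyEq hev).differentiableWithinAt
  · -- countable subcover of `O` by the `Op x`
    obtain ⟨t, htO, htc, hcover⟩ := TopologicalSpace.countable_cover_nhdsWithin
      (f := fun x : D ↦ if hx : x ∈ O then Op ⟨x, hx⟩ else ∅) (s := O) (by
        intro x hx
        simp only [dif_pos hx]
        exact mem_nhdsWithin_of_mem_nhds ((hOopen _).mem_nhds (hOmem ⟨x, hx⟩)))
    have hall : ∀ᵐ w ∂D.vol, ∀ x ∈ t, ∀ hx : x ∈ O, w ∈ Op ⟨x, hx⟩ → u w = h w := by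
      rw [ae_ball_iff htc]
      intro x hxt
      have hxO : x ∈ O := htO hxt
      filter_upwards [hae ⟨x, hxO⟩] with w hw hx' hwO
      rw [hw hwO.1 hwO.2, hh_loc ⟨x, hxO⟩ w hwO]
    filter_upwards [hall] with w hw hwO
    obtain ⟨x, hxt, hwx⟩ : ∃ x ∈ t, w ∈ (if hx : x ∈ O then Op ⟨x, hx⟩ else ∅) := by
      simpa only [mem_iUnion, exists_prop] using hcover hwO
    have hxO : x ∈ O := htO hxt
    rw [dif_pos hxO] at hwx
    exact hw x hxt hxO hwx

/-- **Weyl's lemma for `∂̄` on a flat Riemann domain.** A locally `vol`-integrable `u` with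
`∂̄ u = 0` weakly agrees `vol`-a.e. with a continuous function `h` which is holomorphic along every
local inverse `e` of `proj`. [cite: HormanderSCV1973, §4.2 (Cor. 4.2.6); §5.4] -/
theorem exists_flatHolomorphic_ae_eq {u : D → ℂ} (hu : HasWeakDbar D u fun _ _ ↦ 0) :
    ∃ h : D → ℂ, Continuous h ∧
      (∀ e : OpenPartialHomeomorph D (ι → ℂ), ⇑e = D.proj → DifferentiableOn ℂ (h ∘ e.symm) e.target) ∧
      u =ᵐ[D.vol] h := by
  obtain ⟨h, hc, hhol, hae⟩ := exists_flatHolomorphicOn_ae_eq hu isOpen_univ (fun _ _ _ ↦ rfl)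
  refine ⟨h, continuousOn_univ.1 hc, fun e he ↦ ?_, ?_⟩
  · simpa using hhol e he
  · filter_upwards [hae] with y hy using hy (mem_univ y)

end RiemannDomain

end Literature.Analysis.Complex
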